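import Summits.Ventures.CertifiedManyBodySolver.Observables.KKTBlindnessMixedBlock
import HarnessLib

/-!
# Field independence of the charge-PURE sourced KKT rows on the invariant slice
# (hubbard-cq census (38) / OBSTRUCTIONS v1.7 sentence O10′: «pure-class KZ verdicts hold at every field h ≠ 0 at once»)

HONEST FRAMING: certificate-GRAMMAR bookkeeping about what a sourced KKT relaxation can see on a `U(1)`-invariant
pseudo-state; nothing here is a number of the Hubbard model, an order parameter or a phase word.

Cell hubbard-cq; companion of `KKTBlindness.lean` (hubbard-cq-critic-1's kit: charges `HasCharge`, invariant functionals
`IsInvariant`, the sourced first-order row `firstOrder_sourced_of_invariant` and second-order entry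
`secondOrder_entry_of_invariant`) and `KKTBlindnessMixedBlock.lean` (hubbard-cq-p2: the charge-MIXED Nambu block is
never blind). THIS FILE = critic-1 g3's `section FieldIndependence` (HOME/hubbard-cq-critic-1/KKTBlindness.lean
sha16 bc23613278311264) landed verbatim by hubbard-cq-p5 (lead ACKS 91): on an invariant `ω` the field `h` CANCELS
from every first-order row (neutral generator: the row IS the unsourced row; charge `±2`: the row is `−h·(torque)`,
zero iff the torque is; any other charge: `0 = 0`) and from every second-order entry between generators of EQUAL
charge. Hence the feasibility bit of a sourced KKT program built from first-order rows and charge-pure blocks only is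
the same at every `h ≠ 0`:

* `firstOrder_sourced_eq_of_invariant` — the sourced first-order row charge by charge;
* `firstOrder_sourced_iff_of_invariant` — first-order rows are field-blind on the slice (`h ≠ 0 ≠ h'`);
* `secondOrder_entry_of_invariant_of_charge_eq` — equal-charge second-order entries never see the source;
* `pureBlock_eq_of_invariant` / `pureBlock_posSemidef_iff` — the sourced charge-pure block of an invariant functional
  IS the unsourced block, so its PSD bit is the same at every pair of fields.

Zero compute; no definition; no named fact; no `sorry`. References: critic-1 OBSTRUCTIONS v1.7 (cell file);
R. A. Horn, C. R. Johnson, *Matrix Analysis* (2013), §7.1 [HornJohnson2013].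
-/

noncomputable section

namespace Summit.Ventures.CertifiedManyBodySolver.Observables

open Matrix
open scoped ComplexOrder

namespace KKTBlindness

variable {n : Type*} [Fintype n]

section FieldIndependence

/-! ### Field independence of the charge-PURE rows on the invariant slice (g3, OBSTRUCTIONS v1.7)

On an invariant `ω` the field `h` cancels from every first-order row (neutral generator: the row IS the
unsourced row; charge `±2`: the row is `−h·(torque)`, zero iff the torque is; any other charge: `0 = 0`) and
from every second-order entry between generators of EQUAL charge. Hence the feasibility bit of a sourced
KKT program built from first-order rows and charge-pure blocks only is the same at every `h ≠ 0`. -/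

variable {Nc K D : Matrix n n ℂ} {ω : Matrix n n ℂ →ₗ[ℂ] ℂ}

/-- The sourced first-order row of an invariant functional, charge by charge. -/
theorem firstOrder_sourced_eq_of_invariant (hNc : Ncᴴ = Nc) (hK : HasCharge Nc 0 K)
    (hD : HasCharge Nc (-2) D) (hω : IsInvariant Nc ω) (h : ℂ) {C : Matrix n n ℂ} {q : ℤ}
    (hC : HasCharge Nc q C) :
    ω ((K - h • (D + Dᴴ)) * C - C * (K - h • (D + Dᴴ))) =
      (if q = 0 then ω (K * C - C * K) else 0)
        - h * ((if q = 2 then ω (D * C - C * D) else 0)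
               + (if q = -2 then ω (Dᴴ * C - C * Dᴴ) else 0)) := by
  have hDh : HasCharge Nc 2 Dᴴ := by simpa using hD.conjTranspose hNc
  have e : (K - h • (D + Dᴴ)) * C - C * (K - h • (D + Dᴴ))
      = (K * C - C * K) - h • (D * C - C * D) - h • (Dᴴ * C - C * Dᴴ) := by
    simp only [sub_mul, mul_sub, add_mul, mul_add, Matrix.smul_mul, Matrix.mul_smul, smul_sub,
      smul_add]; abel
  rw [e, map_sub, map_sub, map_smul, map_smul]
  have t1 : ω (K * C - C * K) = if q = 0 then ω (K * C - C * K) else 0 := by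
    split_ifs with hq
    · rfl
    · exact hω q _ hq (by simpa using hK.comm hC)
  have t2 : ω (D * C - C * D) = if q = 2 then ω (D * C - C * D) else 0 := by
    split_ifs with hq
    · rfl
    · exact hω (-2 + q) _ (by omega) (hD.comm hC)
  have t3 : ω (Dᴴ * C - C * Dᴴ) = if q = -2 then ω (Dᴴ * C - C * Dᴴ) else 0 := by
    split_ifs with hq
    · rfl
    · exact hω (2 + q) _ (by omega) (hDh.comm hC)
  rw [smul_eq_mul, smul_eq_mul]
  conv_lhs => rw [t1, t2, t3]
  ring

/-- **First-order rows are field-blind on the slice.** For `h ≠ 0 ≠ h'` the sourced row of an invariant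
functional against a generator of definite charge holds at `h` iff it holds at `h'`. -/
theorem firstOrder_sourced_iff_of_invariant (hNc : Ncᴴ = Nc) (hK : HasCharge Nc 0 K)
    (hD : HasCharge Nc (-2) D) (hω : IsInvariant Nc ω) {h h' : ℂ} (hh : h ≠ 0) (hh' : h' ≠ 0)
    {C : Matrix n n ℂ} {q : ℤ} (hC : HasCharge Nc q C) :
    ω ((K - h • (D + Dᴴ)) * C - C * (K - h • (D + Dᴴ))) = 0 ↔
      ω ((K - h' • (D + Dᴴ)) * C - C * (K - h' • (D + Dᴴ))) = 0 := by
  rw [firstOrder_sourced_eq_of_invariant hNc hK hD hω h hC,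
    firstOrder_sourced_eq_of_invariant hNc hK hD hω h' hC]
  by_cases h0 : q = 0
  · subst h0; simp
  · by_cases h2 : q = 2
    · subst h2; simp [hh, hh']
    · by_cases hm : q = -2
      · subst hm; simp [hh, hh']
      · simp [h0, h2, hm]

/-- Second-order entries between generators of the SAME charge never see the source. -/
theorem secondOrder_entry_of_invariant_of_charge_eq (hNc : Ncᴴ = Nc) (hK : HasCharge Nc 0 K)
    (hD : HasCharge Nc (-2) D) (hω : IsInvariant Nc ω) (h : ℂ) {Ci Cj : Matrix n n ℂ} {q : ℤ}
    (hCi : HasCharge Nc q Ci) (hCj : HasCharge Nc q Cj) :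
    ω (Ciᴴ * ((K - h • (D + Dᴴ)) * Cj - Cj * (K - h • (D + Dᴴ)))) = ω (Ciᴴ * (K * Cj - Cj * K)) := by
  rw [secondOrder_entry_of_invariant hNc hK hD hω h hCi hCj]
  have h1 : ¬ (q = q + 2) := by omega
  have h2 : ¬ (q = q - 2) := by omega
  simp [h1, h2]

/-- **Pure blocks are field-blind on the slice**: the sourced charge-pure block of an invariant functional is
the unsourced block, at every field. -/
theorem pureBlock_eq_of_invariant {m : Type*} (hNc : Ncᴴ = Nc) (hK : HasCharge Nc 0 K)
    (hD : HasCharge Nc (-2) D) (hω : IsInvariant Nc ω) (h : ℂ) {C : m → Matrix n n ℂ} {q : ℤ}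
    (hC : ∀ i, HasCharge Nc q (C i)) :
    (Matrix.of fun i j => ω ((C i)ᴴ * ((K - h • (D + Dᴴ)) * C j - C j * (K - h • (D + Dᴴ))))) =
      Matrix.of fun i j => ω ((C i)ᴴ * (K * C j - C j * K)) := by
  ext i j
  simp only [Matrix.of_apply]
  exact secondOrder_entry_of_invariant_of_charge_eq hNc hK hD hω h (hC i) (hC j)

/-- Hence the PSD condition on a charge-pure block is the same bit at every pair of fields. -/
theorem pureBlock_posSemidef_iff {m : Type*} [Fintype m] (hNc : Ncᴴ = Nc) (hK : HasCharge Nc 0 K)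
    (hD : HasCharge Nc (-2) D) (hω : IsInvariant Nc ω) (h h' : ℂ) {C : m → Matrix n n ℂ} {q : ℤ}
    (hC : ∀ i, HasCharge Nc q (C i)) :
    (Matrix.of fun i j => ω ((C i)ᴴ * ((K - h • (D + Dᴴ)) * C j - C j * (K - h • (D + Dᴴ))))).PosSemidef ↔
      (Matrix.of fun i j =>
        ω ((C i)ᴴ * ((K - h' • (D + Dᴴ)) * C j - C j * (K - h' • (D + Dᴴ))))).PosSemidef := by
  rw [pureBlock_eq_of_invariant hNc hK hD hω h hC, pureBlock_eq_of_invariant hNc hK hD hω h' hC]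

end FieldIndependence

end KKTBlindness

end Summit.Ventures.CertifiedManyBodySolver.Observables

end
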